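import Summits.Ventures.QEC.Census.CertCoverCosetD
import Summits.Ventures.QEC.Census.CertBZPlaneSound
import HarnessLib

/-!
# Cover reduction, part 8: the coset checker with an EXTERNAL enumeration verdict (`Reaches`), for the one big problem
# (qec lane ε; census/search-9/cover/README.md §7: the level-2→1 problem `s = 0` — all words of `ker H^X₇₂` of weight
#  `≤ 8` — has `1.5·10⁸` selections, beyond a single `decide`; every other problem is `≤ 9·10⁵`)

`cosetStructOKD` = the popcount-free checker `cosetOKD` WITHOUT its `scan` conjunct; `cosetOK_of_structD_reaches` puts
the structural verdict (`decide`) together with a `Reaches` fact for the enumeration proved by ANY engine — e.g.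
qec-type-01's lane-parallel `CertBZPlaneSound.reaches_of_segList` (start `(0, 0)`), lifted to the checker's marked start
`(2^|G|, 0)` by `reaches_marker_of_reaches_zero` (the marker only matters at the root, which is checked separately).
HONEST FRAMING: generic; everything proved; no instances, no notation.
-/

namespace Summit.Ventures.QEC.Census

/-- The structural part of `cosetOKD` (everything but the enumeration). (definition) -/
def cosetStructOKD (nq : ℕ) (Hq D : List ℕ) (P : CosetProb) (gD bD : List ℕ) : Bool :=
  synEqOK nq Hq P.y0 P.sigma && decide (P.y0 < 2 ^ nq) && (P.y0 &&& maskOf P.T == 0) &&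
    (gD.length == P.G.length) &&
    ((List.range P.G.length).all fun j => (xorSel D (gD.getD j 0) == P.G.getD j 0) && decide (P.G.getD j 0 < 2 ^ nq)) &&
    systematicOK nq P.G P.T && (maskOf P.T &&& P.U == 0) &&
    (bD.length == P.BU.length) &&
    ((List.range P.BU.length).all fun j =>
      (xorSel D (bD.getD j 0) == P.BU.getD j 0) && decide (P.BU.getD j 0 < 2 ^ nq) && (P.BU.getD j 0 &&& P.U == P.BU.getD j 0)) &&
    ((List.range D.length).all fun i =>
      (xorSel P.G (P.coefG.getD i 0) ^^^ xorSel P.BU (P.coefB.getD i 0)) == D.getD i 0)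

/-- `cosetOKD` is its structural part and the scan. -/
theorem cosetOKD_eq (nq : ℕ) (Hq D : List ℕ) (P : CosetProb) (gD bD : List ℕ) :
    cosetOKD nq Hq D P gD bD = (cosetStructOKD nq Hq D P gD bD &&
      scan (bzLeaf P.f P.allow) (rowPos (P.G.map (clr P.U)) 0) P.f (2 ^ P.G.length) (clr P.U P.y0)) := rfl

/-- **Structural verdict + external `Reaches` ⇒ `cosetOK`.** -/
theorem cosetOK_of_structD_reaches {nq : ℕ} {Hq D : List ℕ} {P : CosetProb} {gD bD : List ℕ}
    (hD : (D.all fun d => synZero nq Hq d) = true) (hs : cosetStructOKD nq Hq D P gD bD = true)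
    (hr : Reaches (bzLeaf P.f P.allow) (rowPos (P.G.map (clr P.U)) 0) P.f (2 ^ P.G.length) (clr P.U P.y0)) :
    cosetOK nq Hq D P = true := by
  refine cosetOK_of_cosetOKD (gD := gD) (bD := bD) hD ?_
  rw [cosetOKD_eq, hs, Bool.true_and]
  exact (scan_eq_true_iff_reaches _ _ _ _ _).2 hr

/-- A nonempty sub-selection of the row positions has a nonzero selection word. -/
theorem xorFst_ne_zero_of_sublist_rowPos (G : List ℕ) {S : List (ℕ × ℕ)} (hS : S.Sublist (rowPos G 0)) (hne : S ≠ []) :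
    xorFst S ≠ 0 := by
  obtain ⟨J, hJ, rfl⟩ := Plane.exists_map_of_sublist_rowPos G hS
  have hJnd : J.Nodup := hJ.nodup List.nodup_range
  cases J with
  | nil => exact absurd rfl hne
  | cons j J' =>
    intro h0
    have := congrArg (fun x => Nat.testBit x j) h0
    simp only [Plane.xorFst_map_pair, testBit_xorList_pow _ hJnd, Nat.zero_testBit, List.mem_cons, true_or,
      decide_true] at this
    exact Bool.noConfusion this

/-- **Marking the start**: a `Reaches` fact for the enumeration started at selection word `0` (the shape every lane
engine proves, e.g. `reaches_of_segList`) gives the checker's start `2^k`, once the root (empty selection: the offset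
word itself) passes the leaf. The marker only feeds `bzLeaf`'s `u == 0` escape, which no nonempty selection takes. -/
theorem reaches_marker_of_reaches_zero (G : List ℕ) {f k c0 : ℕ} {allow : List ℕ}
    (hroot : bzLeaf f allow (2 ^ k) c0 = true) (h : Reaches (bzLeaf f allow) (rowPos G 0) f 0 c0) :
    Reaches (bzLeaf f allow) (rowPos G 0) f (2 ^ k) c0 := by
  intro S hS hlen
  by_cases hne : S = []
  · subst hne
    simpa [xorFst, xorSnd, xorList] using hroot
  · have hS0 := h S hS hlen
    rw [Nat.zero_xor] at hS0
    have hx := xorFst_ne_zero_of_sublist_rowPos G hS hne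
    simp only [bzLeaf, Bool.or_eq_true, beq_iff_eq] at hS0 ⊢
    rcases hS0 with (h1 | h1) | h2
    · exact absurd h1 hx
    · exact Or.inl (Or.inr h1)
    · exact Or.inr h2

end Summit.Ventures.QEC.Census
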